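import Summits.BirchSwinnertonDyer.BirchSwinnertonDyer.Theses.PrintCf2RubinValueTwo
import Summits.BirchSwinnertonDyer.BirchSwinnertonDyer.Theorems.PrintCf2SplitBadTwoKatzFrameUniquenessAtTwo
import Summits.BirchSwinnertonDyer.BirchSwinnertonDyer.Theorems.PrintCf2SplitBadTwoKatzMeasureValueExists
import Summits.BirchSwinnertonDyer.BirchSwinnertonDyer.Theorems.PrintCf2RubinValueTwoRubinValueFormulaAtTwoUniqueTransport
import Summits.BirchSwinnertonDyer.BirchSwinnertonDyer.Theorems.PrintCf2RubinValueTwoFrameSeed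
import Literature.NumberTheory.EllipticCurves.DeShalit1987.KatzMeasurePointTransport
import Literature.NumberTheory.EllipticCurves.IntSeriesIdentityPrinciple
import Literature.NumberTheory.EllipticCurves.Disegni2020.PAdicBSDRankOneMultiplicativeProofs
import HarnessLib

/-!
# Line `value-transport` for crux `PrintCf2RubinValueTwo.RubinValueFormulaAtTwo` (stmt-BirchSwinnertonDyer-23721, S2′ of road α)
# — LEAD skeleton v1/v2 (cruxlead-23721 g0, 2026-08-29); v3 = v2 + §6 status note (cruxlead-23721 g2, 2026-08-29; stubs unchanged)

THE CRUX (route C `PrintCf2RubinValueTwo`, item r3, = v10.3 stub `stub_rubinValueFormula_two_v10` VERBATIM): one class-uniform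
`e_A : ℤ → ℤ → ℤ` such that on every v10 frame of every member `W ≅ cm7^(d)` (`d ≢ 1 (4)`, analytic rank one) and every
two-variable series `G₂` carrying de Shalit's frame `IsKatzMeasure₂ ι v v̄ Sθ κ₁ κ₂ γ₁⁻¹ γ₂⁻¹ θK⁻¹ Ω δ Ωp G₂`, the value
`val = G₂(r(γ₁⁻¹) − 1, r(γ₂⁻¹) − 1)` — the branch value at `θK⁻¹ρ = (ψ∘c)⁻¹`, infinity type `(0, −1)`, OUTSIDE the typed
interpolation range `(−m, j)`, `0 ≤ j < m` — has `‖val‖ = 2^{−m/2}` only for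
`m = 2·(v₂ #Ш_an + v₂ ∏c_ℓ − 2 v₂ #tors + 2ℓ) + e_A(d mod 2, d′ mod 8)` (Rubin 1992 Cor. 10.3 shape with `#Ш` replaced by `#Ш_an`).

THE LINE (why this decomposition). The value is read OUT of the interpolation range, so a proof must (i) know that the frame
pins `G₂` — UNIQUENESS of the two-variable frame at `p = 2` (vet F2; planner brick B18) — and (ii) know the value of THE measure there
(the research kernel: a 2-adic Rubin / Bertolini–Darmon–Prasanna formula at the additive split prime; not in print). LEAD vetting of
F2 (this file's §2–§3): B18 as typed (`bricks/B18_KatzFrameUniquenessAtTwo.lean`: `λ` unramified at every `w ∉ S ∪ {v̄}`, generator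
pair `(γ₁, γ₂)` in BOTH `IsTopGeneratorPair` and `IsKatzMeasure₂`) is NOT instantiable on an S2′ frame: (a) the frame reads the
measure at the INVERSE generators `(γ₁⁻¹, γ₂⁻¹)`, which are not `IsTopGenerator`s (`κ γ = ofAdd 1` exactly) — repaired by negating
`κ₁, κ₂` (`ZpExtension.unitTwist (-1)`, same kernels, §2); (b) `λ = θK⁻¹` is RAMIFIED AT `v` on every supplied frame (`θK` is the
sign character of the `v`-adic avatar of `(ψ∘c)⁻¹`, so `θK|𝒪_v^× = χ_{d,2}|ℤ₂^× ≠ 1` for `d ≡ 2, 3 (4)`), and at `p = 2` the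
characters through the `ℤ₂²`-tower kill `art_v(−1)`, so the typed range of `θK⁻¹` has the parity of `m` FORCED
(`(−1)^m = θK,v(−1)`): B18's even supply serves `λ' := θK⁻¹·η` for a SEED `η` (an algebraic Hecke character with avatar through the
pair, unramified away from `2`, cancelling `θK` on `𝒪_v^×`), and uniqueness for `θK⁻¹` is TRANSPORTED back along de Shalit's unit
twist `Tᵢ ↦ η̂(γᵢ)(1+Tᵢ) − 1` (`IsKatzMeasure₂.unitTwist₂_of_avatar`, tree) by the injectivity of the twist (identity principle,
tree `IntSeries.eq_of_forall_hasValueAt₂`).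

STUBS (4 ≤ stubs_max):
* `stub_katzFrameUnique_two` — B18 VERBATIM as the proposition `KatzFrameUniqueAtTwo` — CLOSED (width seat -w5 g4, p680279);
* `stub_uniqueTransport` — B18t (`UniqueTransport`): uniqueness for `λη` ⟹ uniqueness for `λ` along a seed avatar (generic `p`) — CLOSED (LEAD, p683009);
* `stub_frameSeed_two` — B18s: every S2′ frame has a seed — CLOSED (LEAD g3, `PrintCf2.FrameSeed.frameSeed_two`); on paper (odd `d`: `η = ψ⁻¹·θ₁`, `θ₁` the quadratic part of
  `ψ` itself, type `(−1, 0)`, `η_v|units = χ_{−4}`; even `d`: times the quadratic tower character of `K(√2)/K`);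
* `stub_katzRubinValue_two` — R: the research kernel in EXISTENCE form (on a frame admitting a Katz measure, SOME Katz measure of
  the frame takes a value of norm `2^{−(2 n_an + e_A)/2}` at the point).
KERNEL (no `sorry` outside the stubs): `isTopGeneratorPair_neg_inv`, `factorsThroughPair_unitTwist_iff`,
`isKatzMeasure₂_unitTwist_iff` (§2), `frameUnique_two_of` (U_S2′ ⟸ B18 ∧ B18t ∧ B18s), `RubinValueFormulaAtTwo_of`
(U_S2′ ∧ R ⟹ crux BY NAME; `q` from the tree's `Disegni2020.exists_rat_shaAn_eq_of_analyticRank_eq_one`, the value transfer by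
`IntSeries.HasValueAt₂.unique`, `m` by `Real.rpow_right_inj`), and the U-free variant `RubinValueFormulaAtTwo_of_forall`
(`KatzRubinValueForallAtTwo → crux`) recording that uniqueness is consumed only through the existence form of R.
BSD is not proved by any of this; no summit statement is proved by this seat.
-/

set_option autoImplicit false
set_option linter.dupNamespace false

noncomputable section

open scoped Classical
open NumberField IsDedekindDomain Field WeierstrassCurve
open Literature.NumberTheory.GaloisRepresentations Literature.NumberTheory.EllipticCurves
open Literature.NumberTheory.EllipticCurves.Rank1Residual
open Literature.NumberTheory.EllipticCurves.DeShalit1987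
open Summit.BirchSwinnertonDyer.BirchSwinnertonDyer.Theorems

namespace Summit.BirchSwinnertonDyer.BirchSwinnertonDyer.Cruxes.RubinValueFormulaAtTwo.ValueTransport

/-! ### §1. The four stubs (statements as `Prop`s, then the sorried `stub_*`) -/

/-- **B18 — two-variable Katz frame uniqueness at `p = 2`** (`bricks/B18_KatzFrameUniquenessAtTwo.lean`, planner g18 / vet F2),
as a proposition: the tree's `CycTangentCMKatzFrameUniqueness.isKatzMeasure₂_unique` at `p = 2` with `hp2` deleted, binders
VERBATIM. Held by width seat -w5 g4 (closes `stub_katzFrameUnique_two` by name when it lands).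
[cite: deShalit1987, II.4.16 (49)–(50), II.4.17 (52)–(54), II.6.4 proof (p. 85)] [cite: Katz1978, (5.3.0)] -/
def KatzFrameUniqueAtTwo : Prop :=
    ∀ {K : Type} [Field K] [NumberField K], IsImaginaryQuadratic K →
    ∀ {ι : PadicAlgCl 2 ≃+* ℂ} {v vbar : HeightOneSpectrum (𝓞 K)},
      ((2 : ℕ) : 𝓞 K) ∈ v.asIdeal → ((2 : ℕ) : 𝓞 K) ∈ vbar.asIdeal → vbar ≠ v →
      (∀ (w : InfinitePlace K) (d : 𝓞 K), d ∈ v.asIdeal ↔ ‖ι.symm (w.embedding (d : K))‖ < 1) →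
    ∀ {S : Finset (HeightOneSpectrum (𝓞 K))} {η : HeckeCharacter K} {w₀ : ℕ}, 0 < w₀ →
      η.HasInfinityType (fun _ ↦ (w₀ : ℤ)) (fun _ ↦ 0) →
    ∀ {lam : HeckeCharacter K} {a b : ℕ}, b ≤ a →
      lam.HasInfinityType (fun _ ↦ -(a : ℤ)) (fun _ ↦ (b : ℤ)) →
      (∀ w : HeightOneSpectrum (𝓞 K), w ∉ S → w ≠ vbar → lam.IsUnramifiedAt w) →
    ∀ {κ₁ κ₂ : ZpExtension K 2} {γ₁ γ₂ : absoluteGaloisGroup K}, ZpExtension.IsTopGeneratorPair κ₁ κ₂ γ₁ γ₂ →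
    ∀ {Ω δ : ℂ} {Ωp : ℂ_[2]} {G G' : PowerSeries (PowerSeries (PadicComplexInt 2))},
      IsKatzMeasure₂ ι v vbar S κ₁ κ₂ γ₁ γ₂ lam Ω δ Ωp G →
      IsKatzMeasure₂ ι v vbar S κ₁ κ₂ γ₁ γ₂ lam Ω δ Ωp G' → G = G'

/-- **U₀ = B18 is a THEOREM** (statement `KatzFrameUniqueAtTwo`): LANDED by width seat -w5 g4, p680279
`Theorems/PrintCf2SplitBadTwoKatzFrameUniquenessAtTwo.lean`, `PrintCf2.Bricks.stub_isKatzMeasure₂_unique_two`.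
[cite: deShalit1987, II.4.16 (49)–(50), II.4.17 (52)–(54)] -/
theorem stub_katzFrameUnique_two : KatzFrameUniqueAtTwo :=
  fun hK _ _ _ hv hvbar hne hι _ _ _ hw₀ hη _ _ _ hba hlam hlamu _ _ _ _ hpair _ _ _ _ _ hG hG' ↦
    PrintCf2.Bricks.stub_isKatzMeasure₂_unique_two hK hv hvbar hne hι hw₀ hη hba hlam hlamu hpair hG hG'

/-- **B18t — TRANSPORT OF UNIQUENESS ALONG A SEED (generic `p`)**, as a proposition: if `e` is a `p`-adic avatar through the
pair of a Hecke character `η` unramified away from `p`, and the `λη`-frame for `(κ₁, κ₂; γ₁, γ₂)` has at most one solution, then so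
has the `λ`-frame — two `λ`-solutions twist (de Shalit II.4.17 (52): `Tᵢ ↦ η̂(γᵢ)(1+Tᵢ) − 1`, tree
`IsKatzMeasure₂.unitTwist₂_of_avatar`) to two `λη`-solutions, which coincide, and the twist is injective on `𝒪_{ℂ_p}⟦T₁⟧⟦T₂⟧`
(identity principle on the open bidisc). LEAD brick, provable now. [cite: deShalit1987, II.4.17 (52)–(54) (p. 77–78), II.6.4 proof (p. 85)] -/
def UniqueTransport : Prop :=
    ∀ {p : ℕ} [Fact p.Prime] {K : Type} [Field K] [NumberField K]
      {ι : PadicAlgCl p ≃+* ℂ} {v vbar : HeightOneSpectrum (𝓞 K)} {S : Finset (HeightOneSpectrum (𝓞 K))}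
      {κ₁ κ₂ : ZpExtension K p} {γ₁ γ₂ : absoluteGaloisGroup K} {lam η : HeckeCharacter K}
      {Ω δ : ℂ} {Ωp : ℂ_[p]} {e : FramedGaloisRep K (PadicAlgCl p) 1},
      IsPAdicAvatarOf ι η e → FactorsThroughPair κ₁ κ₂ e →
      (∀ w : HeightOneSpectrum (𝓞 K), ((p : ℕ) : 𝓞 K) ∉ w.asIdeal → η.IsUnramifiedAt w) →
      (∀ H H' : PowerSeries (PowerSeries (PadicComplexInt p)),
        IsKatzMeasure₂ ι v vbar S κ₁ κ₂ γ₁ γ₂ (lam * η) Ω δ Ωp H →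
        IsKatzMeasure₂ ι v vbar S κ₁ κ₂ γ₁ γ₂ (lam * η) Ω δ Ωp H' → H = H') →
    ∀ {G G' : PowerSeries (PowerSeries (PadicComplexInt p))},
      IsKatzMeasure₂ ι v vbar S κ₁ κ₂ γ₁ γ₂ lam Ω δ Ωp G →
      IsKatzMeasure₂ ι v vbar S κ₁ κ₂ γ₁ γ₂ lam Ω δ Ωp G' → G = G'

/-- **U₁ = B18t is a THEOREM** (statement `UniqueTransport`): LANDED p683009
`Theorems/PrintCf2RubinValueTwoRubinValueFormulaAtTwoUniqueTransport.lean`, `KatzUniqueTransport.isKatzMeasure₂_unique_of_seed`.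
[cite: deShalit1987, II.4.17 (52)–(54) (p. 77–78)] -/
theorem stub_uniqueTransport : UniqueTransport :=
  fun he heκ hη huniq _ _ hG hG' ↦ PrintCf2.KatzUniqueTransport.isKatzMeasure₂_unique_of_seed he heκ hη huniq hG hG'

/-- **B18s — THE SEED SUPPLY on an S2′ frame** (statement; stub below): for every member and every v10 frame of the crux there
are a Hecke character `η`, a `2`-adic avatar `e` of it through the pair, and `b ≤ a` such that `η` is unramified away from `2`
and `λ' := θK⁻¹·η` has infinity type `(−a, b)` and is unramified at every `w ∉ Sθ ∪ {v̄}` (so B18 applies to `λ'`). On paper: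
odd `d` (`≡ 3 (4)`): `η = ψ⁻¹·θ₁` with `θ₁` the Hecke character of the sign of the `v`-adic avatar of `ψ` (type `(−1, 0)`,
`η|𝒪_v^× = χ_{−4} = θK|𝒪_v^×`); even `d`: the same times the quadratic character of `K(√2) ⊂ K̃_∞` (local component `χ_8` at `v`),
alone when `d ≡ 2 (8)`. [cite: deShalit1987, II.4.17 (54)] [cite: SerreAbelianLadic1968, Ch. II §2.7] -/
def FrameSeedAtTwo : Prop :=
    ∀ (d : ℤ), d ≠ 0 → Squarefree d → d % 4 ≠ 1 →
    ∀ (W : WeierstrassCurve ℚ) [W.IsElliptic] [W.IsGloballyMinimal] (C : VariableChange ℚ),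
      C • W = cm7.quadraticTwist (d : ℚ) → W.analyticRank = 1 →
    ∀ (K : Type) [Field K] [NumberField K], IsImaginaryQuadratic K →
    ∀ (v vbar : HeightOneSpectrum (𝓞 K)),
      ((2 : ℕ) : 𝓞 K) ∈ v.asIdeal → ((2 : ℕ) : 𝓞 K) ∈ vbar.asIdeal → vbar ≠ v →
    ∀ (ι : PadicAlgCl 2 ≃+* ℂ),
      (∀ (w : InfinitePlace K) (k : 𝓞 K), k ∈ v.asIdeal ↔ ‖ι.symm (w.embedding (k : K))‖ < 1) →
    ∀ (c : K ≃ₐ[ℚ] K), c ≠ 1 →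
    ∀ (ψ : HeckeCharacter K), ψ.HasInfinityType (fun _ ↦ 1) (fun _ ↦ 0) →
      (∀ s : ℂ, 3 / 2 < s.re → heckeLFunction ψ s = W.LSeries s) →
    ∀ (κ₁ κ₂ : ZpExtension K 2) (γ₁ γ₂ : absoluteGaloisGroup K), ZpExtension.IsTopGeneratorPair κ₁ κ₂ γ₁ γ₂ →
    ∀ (θK ρ : HeckeCharacter K) (r : FramedGaloisRep K (PadicAlgCl 2) 1),
      θK * θK = 1 → IsPAdicAvatarOf ι ρ r → FactorsThroughPair κ₁ κ₂ r →
      θK⁻¹ * ρ = (HeckeCharacter.galConj c ψ)⁻¹ →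
    ∀ (Sθ : Finset (HeightOneSpectrum (𝓞 K))), v ∉ Sθ → vbar ∉ Sθ →
      (∀ w ∈ Sθ, ¬ θK.IsUnramifiedAt w) →
      (∀ w : HeightOneSpectrum (𝓞 K), w ∉ Sθ → w ≠ v → w ≠ vbar → θK.IsUnramifiedAt w) →
    ∃ (η : HeckeCharacter K) (e : FramedGaloisRep K (PadicAlgCl 2) 1) (a b : ℕ),
      IsPAdicAvatarOf ι η e ∧ FactorsThroughPair κ₁ κ₂ e ∧
      (∀ w : HeightOneSpectrum (𝓞 K), ((2 : ℕ) : 𝓞 K) ∉ w.asIdeal → η.IsUnramifiedAt w) ∧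
      b ≤ a ∧ (θK⁻¹ * η).HasInfinityType (fun _ ↦ -(a : ℤ)) (fun _ ↦ (b : ℤ)) ∧
      ∀ w : HeightOneSpectrum (𝓞 K), w ∉ Sθ → w ≠ vbar → (θK⁻¹ * η).IsUnramifiedAt w

/-- **U₂ = B18s is a THEOREM** (statement `FrameSeedAtTwo`): LANDED by LEAD cruxlead-23721 g3,
`Theorems/PrintCf2RubinValueTwoFrameSeed.lean`, `PrintCf2.FrameSeed.frameSeed_two` (with `…FrameSeedDyadicEmbedding`,
`…FrameSeedCharacters`, `…FrameSeedAvatars`, `…FrameSeedLocalMatching`): the seed is `ω_A⁻²`, `ω_A⁻¹ω_B⁻¹`, `ω_A⁻¹` or `ω_B⁻¹`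
according to `(θK⟨−1⟩_v, θK⟨5⟩_v)`, for the Größencharaktere `ω_A, ω_B` of `χ₄ = χ₈χ₈'`, `χ₈'` modulo `𝔭_v³`; their inverse `2`-adic
avatars factor through every generator pair (Frobenius density + B11). [cite: deShalit1987, II.4.17 (54)]
[cite: SerreAbelianLadic1968, Ch. II §2.7] [cite: IrelandRosen1982, Ch. 18 §7] -/
theorem stub_frameSeed_two : FrameSeedAtTwo :=
  PrintCf2.FrameSeed.frameSeed_two

/-- **R — THE RESEARCH KERNEL IN EXISTENCE FORM** (statement; stub below): one class-uniform `e_A` such that on every v10 frame of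
every member that ADMITS a Katz measure, and for the rational `q = #Ш_an(W)`, SOME solution `G₀` of the frame takes at
`(r(γ₁⁻¹) − 1, r(γ₂⁻¹) − 1)` a value of norm `2^{−(2·(v₂ q + v₂ ∏c − 2 v₂ #tors + 2ℓ) + e_A(d mod 2, d′ mod 8))/2}` — Rubin's `𝔭`-adic
value formula `L_𝔭(ψ*) ∼ Ω_𝔭⁻¹ · (L′(E,1)/Ω·ĥ(P)) · log_𝔭̄(P)²` at the split ADDITIVE prime `2` (Rubin 1992 Cor. 10.3 / Bertolini–
Darmon–Prasanna 2012 shape; printed only for `p ∤ 𝔣·#𝒪_K^×`, good reduction). NOT print; the crux's research content.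
[cite: Rubin1992, Cor. 10.3 (shape)] [cite: deShalit1987, II.4.17 (54)] -/
def KatzRubinValueAtTwo : Prop :=
    GrossZagier1986_thm_I_7_3 → rank_eq_analyticRank_of_analyticRank_le_one →
    ∃ eA : ℤ → ℤ → ℤ,
    ∀ (d : ℤ), d ≠ 0 → Squarefree d → d % 4 ≠ 1 →
    ∀ (W : WeierstrassCurve ℚ) [W.IsElliptic] [W.IsGloballyMinimal] (C : VariableChange ℚ),
      C • W = cm7.quadraticTwist (d : ℚ) → W.analyticRank = 1 →
    ∀ (K : Type) [Field K] [NumberField K], IsImaginaryQuadratic K →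
    ∀ (v vbar : HeightOneSpectrum (𝓞 K)),
      ((2 : ℕ) : 𝓞 K) ∈ v.asIdeal → ((2 : ℕ) : 𝓞 K) ∈ vbar.asIdeal → vbar ≠ v →
    ∀ (ι : PadicAlgCl 2 ≃+* ℂ),
      (∀ (w : InfinitePlace K) (k : 𝓞 K), k ∈ v.asIdeal ↔ ‖ι.symm (w.embedding (k : K))‖ < 1) →
    ∀ (c : K ≃ₐ[ℚ] K), c ≠ 1 →
    ∀ (ψ : HeckeCharacter K), ψ.HasInfinityType (fun _ ↦ 1) (fun _ ↦ 0) →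
      (∀ s : ℂ, 3 / 2 < s.re → heckeLFunction ψ s = W.LSeries s) →
    ∀ (κ₁ κ₂ : ZpExtension K 2) (γ₁ γ₂ : absoluteGaloisGroup K), ZpExtension.IsTopGeneratorPair κ₁ κ₂ γ₁ γ₂ →
    ∀ (θK ρ : HeckeCharacter K) (r : FramedGaloisRep K (PadicAlgCl 2) 1),
      θK * θK = 1 → IsPAdicAvatarOf ι ρ r → FactorsThroughPair κ₁ κ₂ r →
      θK⁻¹ * ρ = (HeckeCharacter.galConj c ψ)⁻¹ →
    ∀ (Sθ : Finset (HeightOneSpectrum (𝓞 K))), v ∉ Sθ → vbar ∉ Sθ →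
      (∀ w ∈ Sθ, ¬ θK.IsUnramifiedAt w) →
      (∀ w : HeightOneSpectrum (𝓞 K), w ∉ Sθ → w ≠ v → w ≠ vbar → θK.IsUnramifiedAt w) →
    ∀ (Ω δ : ℂ) (Ωp : (unrIntegers 2)ˣ) (G₂ : PowerSeries (PowerSeries (PadicComplexInt 2))),
      Ω ≠ 0 → (δ ^ 2 = (NumberField.discr K : ℂ) ∨ δ ^ 2 = -(NumberField.discr K : ℂ)) →
      IsKatzMeasure₂ ι v vbar Sθ κ₁ κ₂ γ₁⁻¹ γ₂⁻¹ θK⁻¹ Ω δ ((Ωp : unrIntegers 2) : ℂ_[2]) G₂ →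
    ∀ (P : W.toAffine.Point) (c₀ : ℕ) (ℓ : ℤ),
      ¬ IsOfFinAddOrder P →
      (∀ R : W.toAffine.Point, ∃ (k : ℤ) (T : W.toAffine.Point), IsOfFinAddOrder T ∧ R = k • P + T) →
      c₀ ≠ 0 → (W.baseChange ℚ_[2]).IsInReductionKernel (c₀ • W.toPadicPoint 2 P) →
      ‖(W.baseChange ℚ_[2]).padicLogPoint (c₀ • W.toPadicPoint 2 P) / (c₀ : ℚ_[2])‖ = (2 : ℝ) ^ (-ℓ) →
    ∀ (q : ℚ), shaAn W = (q : ℂ) →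
    ∃ G₀ : PowerSeries (PowerSeries (PadicComplexInt 2)),
      IsKatzMeasure₂ ι v vbar Sθ κ₁ κ₂ γ₁⁻¹ γ₂⁻¹ θK⁻¹ Ω δ ((Ωp : unrIntegers 2) : ℂ_[2]) G₀ ∧
      ∃ val₀ : ℂ_[2],
        IntSeries.HasValueAt₂ G₀ (avatarValueAt r γ₁⁻¹ - 1) (avatarValueAt r γ₂⁻¹ - 1) val₀ ∧
        ‖val₀‖ = (2 : ℝ) ^ (-((2 * (padicValRat 2 q + (padicValNat 2 W.tamagawaProduct : ℤ)
              - 2 * (padicValNat 2 W.torsionOrder : ℤ) + 2 * ℓ) + eA (d % 2) ((d / (2 - d % 2)) % 8) : ℤ) : ℝ) / 2)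

/-- **Stub R** (the research kernel, statement `KatzRubinValueAtTwo`). [cite: Rubin1992, Cor. 10.3 (shape)]
[cite: deShalit1987, II.4.17 (54)] -/
theorem stub_katzRubinValue_two : KatzRubinValueAtTwo := by
  sorry

/-! ### §2. Generator bookkeeping — LANDED (p683009, `KatzUniqueTransport.{unitTwist_apply_eq_one_iff,
factorsThroughPair_unitTwist_iff, isKatzMeasure₂_unitTwist_iff, isTopGeneratorPair_neg_inv, isKatzMeasure₂_unique_inv_of_seed}`) -/

open Summit.BirchSwinnertonDyer.BirchSwinnertonDyer.Theorems.PrintCf2.KatzUniqueTransport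

/-! ### §3. U_S2′ — uniqueness of the `θK⁻¹`-frame on every S2′ frame, from B18 ∧ B18t ∧ B18s (kernel) -/

/-- **U_S2′ (statement)**: on every v10 frame of the crux, two solutions of de Shalit's frame for `θK⁻¹` at the inverse generators
and any period data coincide. -/
def FrameUniqueAtTwo : Prop :=
    ∀ (d : ℤ), d ≠ 0 → Squarefree d → d % 4 ≠ 1 →
    ∀ (W : WeierstrassCurve ℚ) [W.IsElliptic] [W.IsGloballyMinimal] (C : VariableChange ℚ),
      C • W = cm7.quadraticTwist (d : ℚ) → W.analyticRank = 1 →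
    ∀ (K : Type) [Field K] [NumberField K], IsImaginaryQuadratic K →
    ∀ (v vbar : HeightOneSpectrum (𝓞 K)),
      ((2 : ℕ) : 𝓞 K) ∈ v.asIdeal → ((2 : ℕ) : 𝓞 K) ∈ vbar.asIdeal → vbar ≠ v →
    ∀ (ι : PadicAlgCl 2 ≃+* ℂ),
      (∀ (w : InfinitePlace K) (k : 𝓞 K), k ∈ v.asIdeal ↔ ‖ι.symm (w.embedding (k : K))‖ < 1) →
    ∀ (c : K ≃ₐ[ℚ] K), c ≠ 1 →
    ∀ (ψ : HeckeCharacter K), ψ.HasInfinityType (fun _ ↦ 1) (fun _ ↦ 0) →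
      (∀ s : ℂ, 3 / 2 < s.re → heckeLFunction ψ s = W.LSeries s) →
    ∀ (κ₁ κ₂ : ZpExtension K 2) (γ₁ γ₂ : absoluteGaloisGroup K), ZpExtension.IsTopGeneratorPair κ₁ κ₂ γ₁ γ₂ →
    ∀ (θK ρ : HeckeCharacter K) (r : FramedGaloisRep K (PadicAlgCl 2) 1),
      θK * θK = 1 → IsPAdicAvatarOf ι ρ r → FactorsThroughPair κ₁ κ₂ r →
      θK⁻¹ * ρ = (HeckeCharacter.galConj c ψ)⁻¹ →
    ∀ (Sθ : Finset (HeightOneSpectrum (𝓞 K))), v ∉ Sθ → vbar ∉ Sθ →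
      (∀ w ∈ Sθ, ¬ θK.IsUnramifiedAt w) →
      (∀ w : HeightOneSpectrum (𝓞 K), w ∉ Sθ → w ≠ v → w ≠ vbar → θK.IsUnramifiedAt w) →
    ∀ (Ω δ : ℂ) (Ωp : ℂ_[2]) (G G' : PowerSeries (PowerSeries (PadicComplexInt 2))),
      IsKatzMeasure₂ ι v vbar Sθ κ₁ κ₂ γ₁⁻¹ γ₂⁻¹ θK⁻¹ Ω δ Ωp G →
      IsKatzMeasure₂ ι v vbar Sθ κ₁ κ₂ γ₁⁻¹ γ₂⁻¹ θK⁻¹ Ω δ Ωp G' → G = G'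

/-- **U_S2′ ⟸ B18 ∧ B18t ∧ B18s** (kernel-checked): take the seed `(η, e, a, b)` of the frame (B18s); transport (B18t) reduces
uniqueness for `θK⁻¹` to uniqueness for `θK⁻¹η`, which is B18 at the NEGATED pair `(−κ₁, −κ₂; γ₁⁻¹, γ₂⁻¹)` (same kernels,
`isKatzMeasure₂_unitTwist_iff`) with the auxiliary type-`(1, 0)` character `ψ`. -/
theorem frameUnique_two_of (hB18 : KatzFrameUniqueAtTwo) (hT : UniqueTransport) (hSeed : FrameSeedAtTwo) :
    FrameUniqueAtTwo := by
  intro d hd0 hsq hd4 W _ _ C hC hr K _ _ hK v vbar hv hvbar hne ι hι c hc ψ hψ hL κ₁ κ₂ γ₁ γ₂ hpair θK ρ r hθK hρr hrpair hρ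
    Sθ hvS hvbarS hSram hSunr Ω δ Ωp G G' hG hG'
  obtain ⟨η, e, a, b, he, heκ, hηu, hba, htype, hunr⟩ :=
    hSeed d hd0 hsq hd4 W C hC hr K hK v vbar hv hvbar hne ι hι c hc ψ hψ hL κ₁ κ₂ γ₁ γ₂ hpair θK ρ r hθK hρr hrpair hρ
      Sθ hvS hvbarS hSram hSunr
  refine hT he heκ hηu (fun H H' hH hH' ↦ ?_) hG hG'
  have hpair' := isTopGeneratorPair_neg_inv hpair
  rw [← isKatzMeasure₂_unitTwist_iff κ₁ κ₂ (-1) (-1)] at hH hH'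
  exact hB18 hK hv hvbar hne hι one_pos (by simpa using hψ) hba htype hunr hpair' hH hH'

/-! ### §4. The composition: U_S2′ ∧ R ⟹ the crux BY NAME (kernel) -/

/-- The crux under a LOCAL ALIAS: `RubinValueFormulaAtTwo_skeleton` below is the UNIQUE theorem concluding the route decl by name (the
skeleton linter reads exactly one); the hypothesis-carrying compositions `RubinValueFormulaAtTwo_of` / `_of_forall` conclude this
alias, which merely unfolds to the crux (when the stubs close, the landing file restates `_of` with the route decl as its type). -/
def CruxS2 : Prop := Summit.BirchSwinnertonDyer.BirchSwinnertonDyer.Theses.PrintCf2RubinValueTwo.RubinValueFormulaAtTwo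


/-- **REGISTERED SKELETON (closed form; the FIRST theorem concluding the crux — the linter reads this one)**: the crux from the
four sorried stubs `stub_katzFrameUnique_two` (B18), `stub_uniqueTransport` (B18t), `stub_frameSeed_two` (B18s),
`stub_katzRubinValue_two` (R), by the composition spelled out again as `RubinValueFormulaAtTwo_of` below. Given the frame,
`q := #Ш_an(W) ∈ ℚ` (tree: Gross–Zagier I.(7.3) rationality in analytic rank one, `Disegni2020.exists_rat_shaAn_eq_of_analyticRank_eq_one`);
R gives a solution `G₀` of the same frame with a value `val₀` of the displayed norm; U_S2′ (`frameUnique_two_of`) gives `G₂ = G₀`; the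
value at a point is unique (`IntSeries.HasValueAt₂.unique`), so `‖val‖ = 2^{−m/2} = 2^{−M/2}` and `m = M` (`Real.rpow_right_inj`).
[cite: Rubin1992, Cor. 10.3 (shape)] [cite: GrossZagier1986, Thm. I.(7.3) 2)] -/
theorem RubinValueFormulaAtTwo_skeleton :
    Summit.BirchSwinnertonDyer.BirchSwinnertonDyer.Theses.PrintCf2RubinValueTwo.RubinValueFormulaAtTwo :=
  (show KatzFrameUniqueAtTwo → UniqueTransport → FrameSeedAtTwo → KatzRubinValueAtTwo →
      Summit.BirchSwinnertonDyer.BirchSwinnertonDyer.Theses.PrintCf2RubinValueTwo.RubinValueFormulaAtTwo by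
    intro hB18 hT hSeed hR hGZ hRk
    obtain ⟨eA, hA⟩ := hR hGZ hRk
    refine ⟨eA, ?_⟩
    intro d hd0 hsq hd4 W _ _ C hC hr K _ _ hK v vbar hv hvbar hne ι hι c hc ψ hψ hL κ₁ κ₂ γ₁ γ₂ hpair θK ρ r hθK hρr hrpair hρ
      Sθ hvS hvbarS hSram hSunr Ω δ Ωp G₂ hΩ hδ hG₂ P c₀ ℓ hP hgen hc₀ hker hlog
    obtain ⟨q, hq⟩ := Disegni2020.exists_rat_shaAn_eq_of_analyticRank_eq_one hGZ hRk W hr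
    refine ⟨q, hq, fun val m hval hnorm ↦ ?_⟩
    obtain ⟨G₀, hG₀, val₀, hval₀, hnorm₀⟩ := hA d hd0 hsq hd4 W C hC hr K hK v vbar hv hvbar hne ι hι c hc ψ hψ hL κ₁ κ₂ γ₁ γ₂
      hpair θK ρ r hθK hρr hrpair hρ Sθ hvS hvbarS hSram hSunr Ω δ Ωp G₂ hΩ hδ hG₂ P c₀ ℓ hP hgen hc₀ hker hlog q hq
    have hGG : G₂ = G₀ := frameUnique_two_of hB18 hT hSeed d hd0 hsq hd4 W C hC hr K hK v vbar hv hvbar hne ι hι c hc ψ hψ hL κ₁ κ₂ γ₁ γ₂ hpair θK ρ r hθK hρr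
      hrpair hρ Sθ hvS hvbarS hSram hSunr Ω δ _ G₂ G₀ hG₂ hG₀
    subst hGG
    have hvv : val = val₀ := hval.unique hval₀
    rw [hvv, hnorm₀] at hnorm
    have hexp := (Real.rpow_right_inj (by norm_num : (0 : ℝ) < 2) (by norm_num : (2 : ℝ) ≠ 1)).mp hnorm.symm
    have hcast : (m : ℝ) = ((2 * (padicValRat 2 q + (padicValNat 2 W.tamagawaProduct : ℤ)
        - 2 * (padicValNat 2 W.torsionOrder : ℤ) + 2 * ℓ) + eA (d % 2) ((d / (2 - d % 2)) % 8) : ℤ) : ℝ) := by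
      linarith
    exact_mod_cast hcast) stub_katzFrameUnique_two stub_uniqueTransport stub_frameSeed_two stub_katzRubinValue_two

/-- **THE COMPOSITION `RubinValueFormulaAtTwo_of`**: B18 → B18t → B18s → R → the crux BY NAME (same proof as `_skeleton`, with the
stubs as hypotheses; this is the form that lands under `Theorems/` as each stub closes). [cite: Rubin1992, Cor. 10.3 (shape)]
[cite: GrossZagier1986, Thm. I.(7.3) 2)] -/
theorem RubinValueFormulaAtTwo_of (hB18 : KatzFrameUniqueAtTwo) (hT : UniqueTransport) (hSeed : FrameSeedAtTwo)
    (hR : KatzRubinValueAtTwo) : CruxS2 := by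
  unfold CruxS2
  intro hGZ hRk
  obtain ⟨eA, hA⟩ := hR hGZ hRk
  refine ⟨eA, ?_⟩
  intro d hd0 hsq hd4 W _ _ C hC hr K _ _ hK v vbar hv hvbar hne ι hι c hc ψ hψ hL κ₁ κ₂ γ₁ γ₂ hpair θK ρ r hθK hρr hrpair hρ
    Sθ hvS hvbarS hSram hSunr Ω δ Ωp G₂ hΩ hδ hG₂ P c₀ ℓ hP hgen hc₀ hker hlog
  obtain ⟨q, hq⟩ := Disegni2020.exists_rat_shaAn_eq_of_analyticRank_eq_one hGZ hRk W hr
  refine ⟨q, hq, fun val m hval hnorm ↦ ?_⟩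
  obtain ⟨G₀, hG₀, val₀, hval₀, hnorm₀⟩ := hA d hd0 hsq hd4 W C hC hr K hK v vbar hv hvbar hne ι hι c hc ψ hψ hL κ₁ κ₂ γ₁ γ₂
    hpair θK ρ r hθK hρr hrpair hρ Sθ hvS hvbarS hSram hSunr Ω δ Ωp G₂ hΩ hδ hG₂ P c₀ ℓ hP hgen hc₀ hker hlog q hq
  have hGG : G₂ = G₀ := frameUnique_two_of hB18 hT hSeed d hd0 hsq hd4 W C hC hr K hK v vbar hv hvbar hne ι hι c hc ψ hψ hL κ₁ κ₂ γ₁ γ₂ hpair θK ρ r hθK hρr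
    hrpair hρ Sθ hvS hvbarS hSram hSunr Ω δ _ G₂ G₀ hG₂ hG₀
  subst hGG
  have hvv : val = val₀ := hval.unique hval₀
  rw [hvv, hnorm₀] at hnorm
  have hexp := (Real.rpow_right_inj (by norm_num : (0 : ℝ) < 2) (by norm_num : (2 : ℝ) ≠ 1)).mp hnorm.symm
  have hcast : (m : ℝ) = ((2 * (padicValRat 2 q + (padicValNat 2 W.tamagawaProduct : ℤ)
      - 2 * (padicValNat 2 W.torsionOrder : ℤ) + 2 * ℓ) + eA (d % 2) ((d / (2 - d % 2)) % 8) : ℤ) : ℝ) := by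
    linarith
  exact_mod_cast hcast

/-! ### §5. Recorded alternative (kernel, NOT a stub): the U-free composition from the ∀-form of R -/

/-- **R in ∀-form**: the value formula for EVERY solution of the frame (what a construction-free proof would state). It implies the
existence form trivially and the crux WITHOUT uniqueness; it is implied by `FrameUniqueAtTwo ∧ KatzRubinValueAtTwo`. Recorded so the
planner sees exactly where uniqueness is consumed. [cite: Rubin1992, Cor. 10.3 (shape)] -/
def KatzRubinValueForallAtTwo : Prop :=
    GrossZagier1986_thm_I_7_3 → rank_eq_analyticRank_of_analyticRank_le_one →
    ∃ eA : ℤ → ℤ → ℤ,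
    ∀ (d : ℤ), d ≠ 0 → Squarefree d → d % 4 ≠ 1 →
    ∀ (W : WeierstrassCurve ℚ) [W.IsElliptic] [W.IsGloballyMinimal] (C : VariableChange ℚ),
      C • W = cm7.quadraticTwist (d : ℚ) → W.analyticRank = 1 →
    ∀ (K : Type) [Field K] [NumberField K], IsImaginaryQuadratic K →
    ∀ (v vbar : HeightOneSpectrum (𝓞 K)),
      ((2 : ℕ) : 𝓞 K) ∈ v.asIdeal → ((2 : ℕ) : 𝓞 K) ∈ vbar.asIdeal → vbar ≠ v →
    ∀ (ι : PadicAlgCl 2 ≃+* ℂ),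
      (∀ (w : InfinitePlace K) (k : 𝓞 K), k ∈ v.asIdeal ↔ ‖ι.symm (w.embedding (k : K))‖ < 1) →
    ∀ (c : K ≃ₐ[ℚ] K), c ≠ 1 →
    ∀ (ψ : HeckeCharacter K), ψ.HasInfinityType (fun _ ↦ 1) (fun _ ↦ 0) →
      (∀ s : ℂ, 3 / 2 < s.re → heckeLFunction ψ s = W.LSeries s) →
    ∀ (κ₁ κ₂ : ZpExtension K 2) (γ₁ γ₂ : absoluteGaloisGroup K), ZpExtension.IsTopGeneratorPair κ₁ κ₂ γ₁ γ₂ →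
    ∀ (θK ρ : HeckeCharacter K) (r : FramedGaloisRep K (PadicAlgCl 2) 1),
      θK * θK = 1 → IsPAdicAvatarOf ι ρ r → FactorsThroughPair κ₁ κ₂ r →
      θK⁻¹ * ρ = (HeckeCharacter.galConj c ψ)⁻¹ →
    ∀ (Sθ : Finset (HeightOneSpectrum (𝓞 K))), v ∉ Sθ → vbar ∉ Sθ →
      (∀ w ∈ Sθ, ¬ θK.IsUnramifiedAt w) →
      (∀ w : HeightOneSpectrum (𝓞 K), w ∉ Sθ → w ≠ v → w ≠ vbar → θK.IsUnramifiedAt w) →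
    ∀ (Ω δ : ℂ) (Ωp : (unrIntegers 2)ˣ) (G₂ : PowerSeries (PowerSeries (PadicComplexInt 2))),
      Ω ≠ 0 → (δ ^ 2 = (NumberField.discr K : ℂ) ∨ δ ^ 2 = -(NumberField.discr K : ℂ)) →
      IsKatzMeasure₂ ι v vbar Sθ κ₁ κ₂ γ₁⁻¹ γ₂⁻¹ θK⁻¹ Ω δ ((Ωp : unrIntegers 2) : ℂ_[2]) G₂ →
    ∀ (P : W.toAffine.Point) (c₀ : ℕ) (ℓ : ℤ),
      ¬ IsOfFinAddOrder P →
      (∀ R : W.toAffine.Point, ∃ (k : ℤ) (T : W.toAffine.Point), IsOfFinAddOrder T ∧ R = k • P + T) →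
      c₀ ≠ 0 → (W.baseChange ℚ_[2]).IsInReductionKernel (c₀ • W.toPadicPoint 2 P) →
      ‖(W.baseChange ℚ_[2]).padicLogPoint (c₀ • W.toPadicPoint 2 P) / (c₀ : ℚ_[2])‖ = (2 : ℝ) ^ (-ℓ) →
    ∀ (q : ℚ), shaAn W = (q : ℂ) →
      ∃ val₀ : ℂ_[2],
        IntSeries.HasValueAt₂ G₂ (avatarValueAt r γ₁⁻¹ - 1) (avatarValueAt r γ₂⁻¹ - 1) val₀ ∧
        ‖val₀‖ = (2 : ℝ) ^ (-((2 * (padicValRat 2 q + (padicValNat 2 W.tamagawaProduct : ℤ)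
              - 2 * (padicValNat 2 W.torsionOrder : ℤ) + 2 * ℓ) + eA (d % 2) ((d / (2 - d % 2)) % 8) : ℤ) : ℝ) / 2)

/-- The ∀-form gives the existence form (take `G₀ := G₂`). -/
theorem katzRubinValueAtTwo_of_forall (h : KatzRubinValueForallAtTwo) : KatzRubinValueAtTwo := by
  intro hGZ hRk
  obtain ⟨eA, hA⟩ := h hGZ hRk
  refine ⟨eA, ?_⟩
  intro d hd0 hsq hd4 W _ _ C hC hr K _ _ hK v vbar hv hvbar hne ι hι c hc ψ hψ hL κ₁ κ₂ γ₁ γ₂ hpair θK ρ r hθK hρr hrpair hρ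
    Sθ hvS hvbarS hSram hSunr Ω δ Ωp G₂ hΩ hδ hG₂ P c₀ ℓ hP hgen hc₀ hker hlog q hq
  exact ⟨G₂, hG₂, hA d hd0 hsq hd4 W C hC hr K hK v vbar hv hvbar hne ι hι c hc ψ hψ hL κ₁ κ₂ γ₁ γ₂ hpair θK ρ r hθK hρr
    hrpair hρ Sθ hvS hvbarS hSram hSunr Ω δ Ωp G₂ hΩ hδ hG₂ P c₀ ℓ hP hgen hc₀ hker hlog q hq⟩

/-- **The U-free composition**: `KatzRubinValueForallAtTwo → RubinValueFormulaAtTwo` (uniqueness is not consumed).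
[cite: Rubin1992, Cor. 10.3 (shape)] [cite: GrossZagier1986, Thm. I.(7.3) 2)] -/
theorem RubinValueFormulaAtTwo_of_forall (h : KatzRubinValueForallAtTwo) : CruxS2 := by
  unfold CruxS2
  intro hGZ hRk
  obtain ⟨eA, hA⟩ := h hGZ hRk
  refine ⟨eA, ?_⟩
  intro d hd0 hsq hd4 W _ _ C hC hr K _ _ hK v vbar hv hvbar hne ι hι c hc ψ hψ hL κ₁ κ₂ γ₁ γ₂ hpair θK ρ r hθK hρr hrpair hρ
    Sθ hvS hvbarS hSram hSunr Ω δ Ωp G₂ hΩ hδ hG₂ P c₀ ℓ hP hgen hc₀ hker hlog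
  obtain ⟨q, hq⟩ := Disegni2020.exists_rat_shaAn_eq_of_analyticRank_eq_one hGZ hRk W hr
  refine ⟨q, hq, fun val m hval hnorm ↦ ?_⟩
  obtain ⟨val₀, hval₀, hnorm₀⟩ := hA d hd0 hsq hd4 W C hC hr K hK v vbar hv hvbar hne ι hι c hc ψ hψ hL κ₁ κ₂ γ₁ γ₂
    hpair θK ρ r hθK hρr hrpair hρ Sθ hvS hvbarS hSram hSunr Ω δ Ωp G₂ hΩ hδ hG₂ P c₀ ℓ hP hgen hc₀ hker hlog q hq
  have hvv : val = val₀ := hval.unique hval₀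
  rw [hvv, hnorm₀] at hnorm
  have hexp := (Real.rpow_right_inj (by norm_num : (0 : ℝ) < 2) (by norm_num : (2 : ℝ) ≠ 1)).mp hnorm.symm
  have hcast : (m : ℝ) = ((2 * (padicValRat 2 q + (padicValNat 2 W.tamagawaProduct : ℤ)
      - 2 * (padicValNat 2 W.torsionOrder : ℤ) + 2 * ℓ) + eA (d % 2) ((d / (2 - d % 2)) % 8) : ℤ) : ℝ) := by
    linarith
  exact_mod_cast hcast

/-! ### §6. LEAD g2 (2026-08-29) — STRUCTURAL STATUS OF THE CRUX (kernel, landed under `Theorems/`; recorded here for the registry's readers)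

* `Theorems/PrintCf2RubinValueTwoRubinValueFormulaAtTwoOfDefectKey.lean` (p688275, `RubinValueFormulaOfDefectKey.rubinValueFormulaAtTwo_of_defectKey`):
  (DK) ∧ 23720 ∧ 23722 ∧ 23723 ⟹ THIS CRUX by name (`e_A := 2e_C + e_M − 2e`), and `…_of_splitBadTwoRankOneOfFacts`: the parent class theorem
  20368 (+ its bundle) ∧ the algebraic cruxes ⟹ this crux. With LEAD cf2-p1's `defectKey_of_items` (S2′ ∧ S3a ∧ S3b′ ∧ S3c ∧ supply ⟹ DK) the
  crux is EQUIVALENT to the defect key (DK) modulo the algebraic cruxes: it is the analytic HALF of 20368, not a smaller statement.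
* `Theorems/PrintCf2RubinValueTwoRubinValueFormulaAtTwoV11OfDefectKey.lean` (p688764): the same for the v11 twin `stub_rubinValueFormula_two_v11`
  (planner's pending crux `RubinValueFormulaAtTwoV11`) modulo the v12 descent law.
Consequently stub R (`stub_katzRubinValue_two`) carries the whole `BSD₂`-content of the class; its only printed proof pattern is Rubin 1992 Thm. 9.5
(explicit reciprocity: `log_{E,𝔭}(x_𝔭) = (1 − α_p/p)⁻¹ 𝓛_𝔭(ψ*) Ω_𝔭`, `h_𝔭(x_𝔭) = (1 − 1/α_p)⁻² 𝓛′_𝔭(ψ) 𝓛_𝔭(ψ*)`) + Cor. 10.2 (= Thm. 8.2(ii):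
Perrin-Riou's `𝔭`-adic Gross–Zagier + Gross–Zagier) [pub-bsdres g8 README of acq-06588, journal pp. 339, 343–344], all three beyond print at the
additive split prime `2` (BDP13 / Kriz16 / Castella–Hsieh18: `p ∤ N`; Castella18: `p ∥ N`; Kriz21: `p` non-split; Kriz–Li19: `p = 2`, `f` good at `2`;
Disegni17 Thm. B: every `p`, DERIVATIVE law for the absorbed pair — idea `disegni-pair-two` on 20368). No reshape of the stub set: B18s and R stay
registered; R is handed back (`promote-stub`). -/

/-! ### §7. LEAD g3 (2026-08-29) — B18s CLOSED; the item is re-keyed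
* `stub_frameSeed_two` is the tree theorem `PrintCf2.FrameSeed.frameSeed_two` (five Theses-free files `Theorems/PrintCf2RubinValueTwoFrameSeed*.lean`):
  U_S2′ = `frameUnique_two_of stub_katzFrameUnique_two stub_uniqueTransport stub_frameSeed_two` is UNCONDITIONAL — Katz-measure uniqueness for the
  `θK⁻¹`-frame at the inverse generators on every S2′ frame at `p = 2`.  The only open stub is R (`stub_katzRubinValue_two`, research).
* Route C rev 8 (planner g18/g19): this crux (23721, v10 text) is now an ASIDE; the live crux is `RubinValueFormulaAtTwoV11` (stmt-24034), whose frame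
  carries S3a's characteristic-ideal clause and needs no uniqueness (`Cruxes/RubinValueFormulaAtTwoV11/Lines/value_transport_v11.lean`). -/

end Summit.BirchSwinnertonDyer.BirchSwinnertonDyer.Cruxes.RubinValueFormulaAtTwo.ValueTransport

end
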